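import Literature.Probability.Percolation.TwoClusterGibbsJointCovariance
import HarnessLib

/-!
# Covariances along the two-cluster Gibbs sampler of van den Berg–Häggström–Kahn (2006), §2.1 — joint tests,
# MEASURE form: the reduction theorem for `prodBernoulli w`, one source vertex `s`, an avoided set `X`

Topic `Literature/Probability/Percolation`; the measure-level form of the finite-sum reduction theorem
`BHK2006.covDST_nonneg_of_withinDST_nonneg` of `TwoClusterGibbsJointCovariance.lean` (BHK's chain run for a test
`h(C_s, C_X)` of BOTH the source cluster and the cluster of the avoided set, decreasing in the latter), in the
vocabulary of the tree's percolation files (`prodBernoulli`, `openEdgeCluster`, `openGraph … Reachable`, set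
integrals over `D = {s ↮ X}`), exactly parallel to `BHK2006_clusterConditionalCov_nonneg_of_within` of
`TwoClusterGibbsCovariance.lean` (test of `C_s` only).  ALL declarations are theorems (no named fact).

`BHK2006_clusterJointTestCov_nonneg_of_within`: if every non-loop pair meeting `X` has `w e < 1`, `h(C, ·)` is
decreasing for every `C`, and for every monotone nonnegative `g` the conditional covariance of `g(C_s)` and
`h(C_s, C_X)` given the cluster of `X` — computed in the fresh configuration `η ∖ A_X(ω)`, `A_X(ω)` the pairs
meeting the open vertex cluster of `X` (Lemma 2.4) — is nonnegative on average over `D`, then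
`μ(D) ∫_D f(C_s) h(C_s, C_X) − (∫_D f(C_s))(∫_D h(C_s, C_X)) ≥ 0` for every monotone `f`.
The hub form used by the mixed conditioned slack hierarchy (test `Σ_u c(u)·1{s↔u} + c₀·1{Σ↔s}·1{Σ↮X}`) is in
`TwoClusterGibbsHubCovariance.lean`.  Not here: closure over degenerate weights (only the fixed-weight form is
needed inside the hierarchy's induction; the device of `…_of_forall_nondegenerate` applies verbatim if wanted).
[cite: VandenbergHaggstromKahn2005, §2.1 pp. 9–13 (Lemmas 2.3–2.4, the chain, Claim 2.5, Remark 2.8)]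
-/

noncomputable section

open MeasureTheory unitInterval
open Literature.Probability.LatticeModels (prodBernoulli)

namespace Literature.Probability.Percolation

/-! ### Measure-level statements for `prodBernoulli w`, one source vertex `s`, target set `X`, joint test -/

section Measure

variable {V : Type*} [Fintype V]

open scoped Classical
open BHK2006 DecisionTree

/-- Total mass of the product weights is `1`. [folklore] -/
private theorem sum_weight_eq_one' (w : Sym2 V → unitInterval) :
    ∑ ω : Set (Sym2 V), weight (fun e => (w e : ℝ)) ω = 1 := by
  have h1 := integral_prodBernoulli_eq_sum w fun _ => (1 : ℝ)
  simp only [integral_const, probReal_univ, smul_eq_mul, mul_one] at h1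
  exact h1.symm

omit [Fintype V] in
/-- `D = {s ↮ X}` in the two-set form. [folklore] -/
private theorem mem_D_iff' (s : V) (X : Set V) (ω : BondConfig V) :
    ω ∈ {ω : BondConfig V | ∀ x ∈ X, ¬ (openGraph ω).Reachable s x} ↔
      ∀ s' ∈ ({s} : Set V), ∀ t ∈ X, ¬ (openGraph ω).Reachable s' t := by
  simp only [Set.mem_setOf_eq, Set.mem_singleton_iff, forall_eq]

/-- `μ(D)` as a weighted sum. [folklore] -/
private theorem real_D_eq_sum' (w : Sym2 V → unitInterval) (s : V) (X : Set V) :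
    (prodBernoulli w).real {ω : BondConfig V | ∀ x ∈ X, ¬ (openGraph ω).Reachable s x} =
      ∑ ω, weight (fun e => (w e : ℝ)) ω *
        ind {ω : BondConfig V | ∀ x ∈ X, ¬ (openGraph ω).Reachable s x} ω := by
  rw [← integral_indicator_one (MeasurableSet.of_discrete), integral_prodBernoulli_eq_sum]
  refine Finset.sum_congr rfl fun ω _ => ?_
  by_cases hω : ω ∈ {ω : BondConfig V | ∀ x ∈ X, ¬ (openGraph ω).Reachable s x}
  · rw [Set.indicator_of_mem hω, ind_of_mem hω, Pi.one_apply]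
  · rw [Set.indicator_of_notMem hω, ind_of_not_mem hω, mul_zero]

/-- `∫_D ψ(C_s, C_X) dμ` as a weighted sum (joint integrand). [folklore] -/
private theorem setIntegral_D_eq_sum₂ (w : Sym2 V → unitInterval) (s : V) (X : Set V)
    (ψ : Set (Sym2 V) → Set (Sym2 V) → ℝ) :
    ∫ ω in {ω : BondConfig V | ∀ x ∈ X, ¬ (openGraph ω).Reachable s x},
        ψ (openEdgeCluster ω s) (setCl ω X) ∂(prodBernoulli w) =
      ∑ ω, weight (fun e => (w e : ℝ)) ω * (ψ (setCl ω {s}) (setCl ω X) *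
        ind {ω : BondConfig V | ∀ x ∈ X, ¬ (openGraph ω).Reachable s x} ω) := by
  rw [← integral_indicator (MeasurableSet.of_discrete), integral_prodBernoulli_eq_sum]
  refine Finset.sum_congr rfl fun ω _ => ?_
  rw [setCl_singleton]
  by_cases hω : ω ∈ {ω : BondConfig V | ∀ x ∈ X, ¬ (openGraph ω).Reachable s x}
  · rw [Set.indicator_of_mem hω, ind_of_mem hω, mul_one]
  · simp only [Set.indicator_of_notMem hω, ind_of_not_mem hω, mul_zero]

/-- **Reduction theorem for a joint test, measure form.**  Bond percolation `μ = prodBernoulli w` on a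
finite vertex type, a vertex `s`, a vertex set `X` such that every non-loop pair meeting `X` has `w e < 1`,
`D = {s ↮ X}`, `C_s` the open edge cluster of `s`, `C_X` the open edge cluster of the set `X`, `A_X(ω)` the
pairs meeting the open vertex cluster of `X`, and a joint test `h(C_s, C_X)` that is DECREASING in `C_X`.
If for every monotone nonnegative `g`
`0 ≤ ∫_D ( E_η[g(C_s(η∖A_X ω)) h(C_s(η∖A_X ω), C_X ω)] − E_η[g(C_s(η∖A_X ω))]·E_η[h(C_s(η∖A_X ω), C_X ω)] ) dμ(ω)`
(the conditional covariance of `g(C_s)` and `h(C_s, C_X)` given the cluster of `X`, averaged over `D`),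
then for every monotone `f`
`0 ≤ μ(D) ∫_D f(C_s) h(C_s, C_X) dμ − (∫_D f(C_s) dμ)(∫_D h(C_s, C_X) dμ)`.
[cite: VandenbergHaggstromKahn2005, §2.1 pp. 10–13 — corollary, derived here] -/
theorem BHK2006_clusterJointTestCov_nonneg_of_within (w : Sym2 V → unitInterval) (s : V) (X : Set V)
    (hX : ∀ e : Sym2 V, ¬ e.IsDiag → (∃ v ∈ e, v ∈ X) → (w e : ℝ) < 1)
    (h : Set (Sym2 V) → Set (Sym2 V) → ℝ) (hh : ∀ A, Antitone (h A))
    (hR : ∀ g : Set (Sym2 V) → ℝ, Monotone g → (∀ C, 0 ≤ g C) →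
      0 ≤ ∫ ω in {ω : BondConfig V | ∀ x ∈ X, ¬ (openGraph ω).Reachable s x},
        ((∫ η, g (openEdgeCluster (η \ {e | ∃ v ∈ e, ∃ x ∈ X, (openGraph ω).Reachable x v}) s) *
              h (openEdgeCluster (η \ {e | ∃ v ∈ e, ∃ x ∈ X, (openGraph ω).Reachable x v}) s)
                (setCl ω X) ∂(prodBernoulli w)) -
          (∫ η, g (openEdgeCluster (η \ {e | ∃ v ∈ e, ∃ x ∈ X, (openGraph ω).Reachable x v}) s)
            ∂(prodBernoulli w)) *
          (∫ η, h (openEdgeCluster (η \ {e | ∃ v ∈ e, ∃ x ∈ X, (openGraph ω).Reachable x v}) s)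
            (setCl ω X) ∂(prodBernoulli w))) ∂(prodBernoulli w))
    (f : Set (Sym2 V) → ℝ) (hf : Monotone f) :
    0 ≤ (prodBernoulli w).real {ω : BondConfig V | ∀ x ∈ X, ¬ (openGraph ω).Reachable s x} *
        (∫ ω in {ω : BondConfig V | ∀ x ∈ X, ¬ (openGraph ω).Reachable s x},
          f (openEdgeCluster ω s) * h (openEdgeCluster ω s) (setCl ω X) ∂(prodBernoulli w)) -
      (∫ ω in {ω : BondConfig V | ∀ x ∈ X, ¬ (openGraph ω).Reachable s x},
          f (openEdgeCluster ω s) ∂(prodBernoulli w)) *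
        (∫ ω in {ω : BondConfig V | ∀ x ∈ X, ¬ (openGraph ω).Reachable s x},
          h (openEdgeCluster ω s) (setCl ω X) ∂(prodBernoulli w)) := by
  classical
  set D : Set (BondConfig V) := {ω | ∀ x ∈ X, ¬ (openGraph ω).Reachable s x} with hDdef
  set w' : Sym2 V → ℝ := fun e => (w e : ℝ) with hw'
  have hw0 : ∀ e, 0 ≤ w' e := fun e => (w e).2.1
  have hw1 : ∀ e, w' e ≤ 1 := fun e => (w e).2.2
  have hm : ∑ ω, weight w' ω = 1 := sum_weight_eq_one' w
  have hD : ∀ ω, ω ∈ D ↔ ∀ s' ∈ ({s} : Set V), ∀ t ∈ X, ¬ (openGraph ω).Reachable s' t :=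
    mem_D_iff' s X
  -- positivity of the regeneration weight
  have hε : 0 < regenWeight w' X := by
    rw [hw', regenWeight_eq_prod w X]
    refine Finset.prod_pos fun e he => ?_
    obtain ⟨hd, hv⟩ := (Finset.mem_filter.1 he).2
    exact sub_pos.2 (hX e hd hv)
  -- the conclusion in sum form
  have hcov : (prodBernoulli w).real D * (∫ ω in D, f (openEdgeCluster ω s) *
      h (openEdgeCluster ω s) (setCl ω X) ∂(prodBernoulli w)) -
      (∫ ω in D, f (openEdgeCluster ω s) ∂(prodBernoulli w)) *
        (∫ ω in D, h (openEdgeCluster ω s) (setCl ω X) ∂(prodBernoulli w)) = covDST w' {s} X D f h := by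
    rw [covDST, real_D_eq_sum' w s X, setIntegral_D_eq_sum₂ w s X (fun C B => f C * h C B),
      setIntegral_D_eq_sum₂ w s X (fun C _ => f C), setIntegral_D_eq_sum₂ w s X h]
  rw [hcov]
  refine covDST_nonneg_of_withinDST_nonneg hw0 hw1 hm {s} X hD hε hh (fun g hg hg0 => ?_) hf
  -- the hypothesis in sum form
  have hwithin : ∫ ω in D,
      ((∫ η, g (openEdgeCluster (η \ {e | ∃ v ∈ e, ∃ x ∈ X, (openGraph ω).Reachable x v}) s) *
            h (openEdgeCluster (η \ {e | ∃ v ∈ e, ∃ x ∈ X, (openGraph ω).Reachable x v}) s) (setCl ω X)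
          ∂(prodBernoulli w)) -
        (∫ η, g (openEdgeCluster (η \ {e | ∃ v ∈ e, ∃ x ∈ X, (openGraph ω).Reachable x v}) s)
          ∂(prodBernoulli w)) *
        (∫ η, h (openEdgeCluster (η \ {e | ∃ v ∈ e, ∃ x ∈ X, (openGraph ω).Reachable x v}) s) (setCl ω X)
          ∂(prodBernoulli w))) ∂(prodBernoulli w) = withinDST w' {s} X D g h := by
    rw [withinDST, ← integral_indicator (MeasurableSet.of_discrete), integral_prodBernoulli_eq_sum]
    refine Finset.sum_congr rfl fun ω _ => ?_
    by_cases hω : ω ∈ D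
    · rw [Set.indicator_of_mem hω, ind_of_mem hω, mul_one, condCovST,
        integral_sdiff_eq_condS w s X (fun A => g A * h A (setCl ω X)) ω, integral_sdiff_eq_condS w s X g ω,
        integral_sdiff_eq_condS w s X (fun A => h A (setCl ω X)) ω]
    · simp only [Set.indicator_of_notMem hω, ind_of_not_mem hω, mul_zero]
  rw [← hwithin]
  exact hR g hg hg0

end Measure

end Literature.Probability.Percolation

end
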